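import Summits.CriticalPhenomena.PercolationContinuityZ3.Theorems.Transplant.KNLevelsDefs
import Summits.CriticalPhenomena.PercolationContinuityZ3.Theorems.Transplant.UniqZoneGeneric
import HarnessLib

/-!
# F6 (generic), part 1 — Kozma–Nitzan Lemma 10, STEP IV over any locally finite graph: behind a contact, a cube whose face carries a
# vertex reliably joined to the target, conditionally on the shell (generalises `L/KozmaNitzanTargetLemma.lean` ll. 145–211, 351–534)

builds on p205010 (kernel theorem, internal audit signed; external expert review pending) — nothing in this file uses p205010.
Lane `prim-bschramm`, seat `prim-bschramm-p3` (task F6-prod = Target Lemma Steps III–V, continuation of F5-prod p210475/p211058/p211364);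
helper file (`--supports stmt-CriticalPhenomena-4575 --as helper`).  BLUEPRINT-I-PHI §1 row "cube behind a contact", §3 file Φ7.

Kozma–Nitzan's Step IV (arXiv:2401.12397 §4 pp. 19–21, (21) ⟹ (24) ⟹ (25)) is graph-free once the cube `v + Λ_M` and its inner ball
`v + Λ_m` are replaced by two finite vertex sets `Λ k ⊆ Λ n` of a sequence `Λ : ℕ → Finset V` (so that p2's generic uniqueness zone
`UniqZone.zone G Λ k n` — Kozma–Nitzan's Lemma 7 event — is the uniqueness input), the orthant face `U` by any subset of the inner vertex
boundary of `Λ n` in `G`, and "lattice edge" by "edge of `G`" (the a.s. event `lattOnly G D` of `KNLevelsDefs`):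
* §1 the link events `linkIn U S T` over `G` (monotone, local, measurable);
* §2 locality / measurability of `UniqZone.toBdry` and `UniqZone.zone` (determined by the pairs inside `Λ n`);
* §3 `GoodVertex W S T δ ω u` (the set `A_ξ` of KN p. 21) and **`stepIV_in` / `stepIV`**: if, with `prodBernoulli W`-probability
  `> 1 - δ²` each, the uniqueness zone `zone Λ k n` holds, `Λ k` is joined to `U ⊆ ∂^{in}(Λ n)` inside `Λ n`, and `Λ k` is joined inside
  `Qt ⊆ D` to a set `Ft ⊆ T` disjoint from `Λ n`, then with probability `≥ 1 - 3δ` some `u ∈ U` satisfies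
  `P(u ↔ T inside Rg | ω|_{E(S)}) > 1 - δ` (`Λ n ⊆ S`, any region `Rg ⊇ Λ n ∪ Qt`; Markov over the local cylinders of `E(S)`).
Proofs: the original's, line by line.

[cite: KozmaNitzan2024, §4 Lemma 10, pp. 19–21 (Step IV, (21)–(25)) — the ℤ^d model] [cite: GrimmettPercolation1999, §7.2]
-/

noncomputable section

open MeasureTheory ProbabilityTheory
open scoped ENNReal

namespace Summit.CriticalPhenomena.PercolationContinuityZ3.Theorems

namespace Transplant

namespace KNLevels

open Literature.Probability.Percolation Literature.Probability.LatticeModels SimpleGraph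

variable {V : Type*} [DecidableEq V] (G : SimpleGraph V) [G.LocallyFinite]

/-! ## §1 The link events -/

omit [DecidableEq V] [G.LocallyFinite] in
/-- `{S ↔ T in U}`: some vertex of `S` is joined to some vertex of `T` by an open path inside `U` (KN: "`[-m,m]^d ↔^{ℓQ} ℓF`", p. 16).
Generalises `KozmaNitzan.linkIn`. [cite: KozmaNitzan2024, §4 p. 16 (Definition of a hittable geometry)] -/
def linkIn (U : Set V) (S T : Finset V) : Set (BondConfig V) :=
  {ω | ∃ s ∈ S, ∃ t ∈ T, ω ∈ openConnIn U s t}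

omit [DecidableEq V] [G.LocallyFinite] in
/-- Membership in `linkIn`. [folklore] -/
theorem mem_linkIn_iff {U : Set V} {S T : Finset V} {ω : BondConfig V} :
    ω ∈ linkIn U S T ↔ ∃ s ∈ S, ∃ t ∈ T, ω ∈ openConnIn U s t := Iff.rfl

omit [DecidableEq V] [G.LocallyFinite] in
/-- `linkIn` as a finite union. [folklore] -/
theorem linkIn_eq_biUnion (U : Set V) (S T : Finset V) :
    linkIn U S T = ⋃ s ∈ S, ⋃ t ∈ T, openConnIn U s t := by
  ext ω; simp [linkIn]

omit [DecidableEq V] [G.LocallyFinite] in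
/-- `linkIn` is measurable for finite `U`. [folklore] -/
theorem measurableSet_linkIn (U S T : Finset V) : MeasurableSet (linkIn (↑U : Set V) S T) := by
  rw [linkIn_eq_biUnion]
  exact Finset.measurableSet_biUnion _ fun s _ => Finset.measurableSet_biUnion _ fun t _ =>
    DCT16.measurableSet_openConnIn U s t

omit [DecidableEq V] [G.LocallyFinite] in
/-- `linkIn` is determined by the off-diagonal pairs inside `U`. [folklore] -/
theorem determinedBy_linkIn (U : Set V) (S T : Finset V) {K : Set (Sym2 V)}
    (hK : wireSet U ⊆ K) : DeterminedBy (linkIn U S T) K := by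
  rw [determinedBy_iff]
  intro ω ω' hω
  simp only [mem_linkIn_iff]
  refine exists_congr fun s => and_congr_right fun _ => exists_congr fun t => and_congr_right fun _ => ?_
  exact (determinedBy_iff _ _).1 (KozmaNitzan.determinedBy_openConnIn_wireSet U s t hK) ω ω' hω

omit [DecidableEq V] [G.LocallyFinite] in
/-- `linkIn` is monotone in all three arguments. [folklore] -/
theorem linkIn_mono {U U' : Set V} {S S' T T' : Finset V} (hU : U ⊆ U') (hS : S ⊆ S')
    (hT : T ⊆ T') : linkIn U S T ⊆ linkIn U' S' T' := by
  rintro ω ⟨s, hs, t, ht, h⟩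
  refine ⟨s, hS hs, t, hT ht, ?_⟩
  rw [DCT16.mem_openConnIn_iff_pathIn] at h ⊢
  exact h.mono hU

/-! ## §2 Locality of the uniqueness zone -/

variable {G}

/-- `UniqZone.toBdry` is determined by the off-diagonal pairs inside `Λ n`. [folklore] -/
theorem determinedBy_toBdry (Λ : ℕ → Finset V) (n : ℕ) (x : V) {K : Set (Sym2 V)}
    (hK : wireSet (↑(Λ n) : Set V) ⊆ K) : DeterminedBy (UniqZone.toBdry G Λ n x) K := by
  rw [determinedBy_iff]
  intro ω ω' hω
  simp only [UniqZone.toBdry, Set.mem_setOf_eq]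
  refine exists_congr fun w => and_congr_right fun _ => ?_
  exact (determinedBy_iff _ _).1 (KozmaNitzan.determinedBy_openConnIn_wireSet _ x w hK) ω ω' hω

/-- `UniqZone.zone` is determined by the off-diagonal pairs inside `Λ n`. [folklore] -/
theorem determinedBy_zone (Λ : ℕ → Finset V) (k n : ℕ) {K : Set (Sym2 V)}
    (hK : wireSet (↑(Λ n) : Set V) ⊆ K) : DeterminedBy (UniqZone.zone G Λ k n) K := by
  rw [determinedBy_iff]
  intro ω ω' hω
  simp only [UniqZone.zone, Set.mem_setOf_eq]
  refine forall₂_congr fun x _ => forall₂_congr fun y _ => ?_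
  rw [(determinedBy_iff _ _).1 (determinedBy_toBdry Λ n x hK) ω ω' hω,
    (determinedBy_iff _ _).1 (determinedBy_toBdry Λ n y hK) ω ω' hω,
    (determinedBy_iff _ _).1 (KozmaNitzan.determinedBy_openConnIn_wireSet _ x y hK) ω ω' hω]

/-- `UniqZone.zone` is measurable. [folklore] -/
theorem measurableSet_zone (Λ : ℕ → Finset V) (k n : ℕ) : MeasurableSet (UniqZone.zone G Λ k n) :=
  (determinedBy_zone Λ k n (K := ↑(pairsF (Λ n))) (by rw [coe_pairsF])).measurableSet_of_finset

/-! ## §3 Step IV: behind every contact there is a vertex of `A_ξ` -/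

omit [DecidableEq V] [G.LocallyFinite] in
/-- The set `A_ξ` of KN p. 21 (vertices `u` of the shell `S` with `P_{K_ξ}(u ↔ T) > 1 - δ`), as a predicate on `(ω, u)`: the
conditional probability given the states of the pairs inside `S` that `u` is joined to `T` exceeds `1 - δ`. Generalises
`KozmaNitzan.GoodVertex`. [cite: KozmaNitzan2024, §4 p. 21 (the set A_ξ)] -/
def GoodVertex (W : Sym2 V → unitInterval) (S T : Finset V) (δ : ℝ) (ω : BondConfig V) (u : V) : Prop :=
  1 - δ < (prodBernoulli (pinW W (wireSet (↑S : Set V)) ω)).real (⋃ t ∈ T, openConn u t)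

omit [DecidableEq V] [G.LocallyFinite] in
/-- `GoodVertex` only depends on the pattern of `ω` on the pairs inside `S`. [folklore] -/
theorem goodVertex_congr {W : Sym2 V → unitInterval} {S T : Finset V} {δ : ℝ}
    {ω ω' : BondConfig V} (h : ∀ e ∈ wireSet (↑S : Set V), e ∈ ω ↔ e ∈ ω') (u : V) :
    GoodVertex W S T δ ω u ↔ GoodVertex W S T δ ω' u := by
  unfold GoodVertex
  rw [pinW_congr W h]

/-- **Step IV with region-internal reliability** (KN pp. 19–21, (21) ⟹ (24) ⟹ (25)) over `G`: let `Λ k ⊆ Λ n ⊆ S` be the inner ball and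
the cube, `U ⊆ ∂^{in}(Λ n)` a part of the cube's inner boundary, `Qt ⊆ D` a route region and `Ft ⊆ T` a landing set disjoint from the cube;
suppose that with `prodBernoulli W`-probability `> 1 - δ²` each: the uniqueness zone `zone Λ k n` holds, `Λ k` is joined to `U` inside `Λ n`,
and `Λ k` is joined to `Ft` inside `Qt`. Then for every region `Rg ⊇ Λ n ∪ Qt`, with probability `≥ 1 - 3δ` some vertex `u ∈ U` satisfies
`P(u ↔ T inside Rg | ω|_{E(S)}) > 1 - δ`. [cite: KozmaNitzan2024, §4 pp. 19–21 (Step IV, (21)–(25)); p. 16 (definition of a target)] -/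
theorem stepIV_in {W : Sym2 V → unitInterval} {p : unitInterval} {D S T U Qt Ft : Finset V}
    (hW : IsSubbox G W p D) (hT : Ft ⊆ T) (hQt : Qt ⊆ D) (Λ : ℕ → Finset V) {k n : ℕ} (hkn : Λ k ⊆ Λ n)
    (hQS : Λ n ⊆ S) (hU : U ⊆ innerBoundary G (Λ n))
    (hfar : Disjoint Ft (Λ n)) {δ : ℝ} (hδ : 0 < δ) {Rg : Set V}
    (hRb : (↑(Λ n) : Set V) ⊆ Rg) (hRQ : (↑Qt : Set V) ⊆ Rg)
    (h1 : 1 - δ ^ 2 < (prodBernoulli W).real (UniqZone.zone G Λ k n))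
    (h2 : 1 - δ ^ 2 < (prodBernoulli W).real (linkIn (↑(Λ n)) (Λ k) U))
    (h3 : 1 - δ ^ 2 < (prodBernoulli W).real (linkIn (↑Qt) (Λ k) Ft)) :
    1 - 3 * δ ≤ (prodBernoulli W).real {ω | ∃ u ∈ U,
      1 - δ < (prodBernoulli (pinW W (wireSet (↑S : Set V)) ω)).real
        (⋃ t ∈ T, openConnIn Rg u t)} := by
  classical
  -- trivial when `δ > 1`
  rcases le_or_gt δ 1 with hδ1 | hδ1
  swap
  · exact le_trans (by linarith) measureReal_nonneg
  set μ := prodBernoulli W with hμ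
  -- the good event `𝒢`
  set Gd : Set (BondConfig V) := UniqZone.zone G Λ k n ∩ linkIn (↑(Λ n)) (Λ k) U ∩
    linkIn (↑Qt) (Λ k) Ft ∩ lattOnly G D with hGd
  have hGm : MeasurableSet Gd := by
    refine (((measurableSet_zone Λ k n).inter (measurableSet_linkIn _ _ _)).inter
      (measurableSet_linkIn _ _ _)).inter ?_
    refine (DeterminedBy.measurableSet_of_finset (F := pairsF D) ?_)
    rw [determinedBy_iff]
    intro ω ω' hω
    simp only [lattOnly, Set.mem_setOf_eq]
    refine forall₂_congr fun e he => ?_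
    have := Set.ext_iff.1 hω e
    simp only [Set.mem_inter_iff, Finset.mem_coe] at this
    rw [show (e ∈ ω ↔ e ∈ ω') from ⟨fun h' => (this.1 ⟨h', he⟩).1, fun h' => (this.2 ⟨h', he⟩).1⟩]
  -- `μ 𝒢 > 1 - 3 δ²`
  have hGprob : 1 - 3 * δ ^ 2 < μ.real Gd := by
    have hL : μ.real (lattOnly G D)ᶜ = 0 := hW.real_compl_lattOnly
    have hcov : Gdᶜ ⊆ (UniqZone.zone G Λ k n)ᶜ ∪ (linkIn (↑(Λ n)) (Λ k) U)ᶜ ∪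
        (linkIn (↑Qt) (Λ k) Ft)ᶜ ∪ (lattOnly G D)ᶜ := by
      intro ω hω
      simp only [hGd, Set.mem_compl_iff, Set.mem_inter_iff, not_and, Set.mem_union] at hω ⊢
      tauto
    have hb := (measureReal_mono hcov (μ := μ)).trans ((measureReal_union_le _ _).trans
      (add_le_add ((measureReal_union_le _ _).trans (add_le_add (measureReal_union_le _ _) le_rfl)) le_rfl))
    rw [measureReal_compl (measurableSet_zone Λ k n), measureReal_compl (measurableSet_linkIn _ _ _),
      measureReal_compl (measurableSet_linkIn _ _ _), hL, probReal_univ, measureReal_compl hGm,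
      probReal_univ] at hb
    linarith
  -- Markov: the low-conditional-probability event has mass `< 3δ`
  set F := pairsF S with hF
  have hFS : (↑F : Set (Sym2 V)) = wireSet (↑S : Set V) := coe_pairsF S
  have hMarkov := prodBernoulli_real_pinLow_le' W F hGm δ
  have hLlt : μ.real (pinLow W ↑F Gd δ) < 3 * δ := by
    by_contra hge
    push Not at hge
    have : δ * (3 * δ) ≤ δ * μ.real (pinLow W ↑F Gd δ) := mul_le_mul_of_nonneg_left hge hδ.le
    nlinarith
  -- outside it, some `u ∈ U` is a good vertex (reliable to `T` inside `Rg`)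
  have hincl : (pinLow W ↑F Gd δ)ᶜ ⊆ {ω | ∃ u ∈ U,
      1 - δ < (prodBernoulli (pinW W (wireSet (↑S : Set V)) ω)).real
        (⋃ t ∈ T, openConnIn Rg u t)} := by
    intro ω hω
    simp only [Set.mem_compl_iff, mem_pinLow_iff, not_le] at hω
    -- a configuration of `𝒢` in the cylinder of `ω`
    have hpos : 0 < (prodBernoulli (pinW W ↑F ω)).real (Gd ∩ localCylinder ↑F ω) := by
      rw [prodBernoulli_pinW_real_inter_localCylinder W (F.finite_toSet.countable) ω Gd]
      exact lt_of_le_of_lt (sub_nonneg.2 hδ1) hω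
    obtain ⟨ω₁, hω₁G, hω₁c⟩ := nonempty_of_measureReal_ne_zero (ne_of_gt hpos)
    -- the arm to `U` and the uniqueness zone, valid throughout the cylinder
    obtain ⟨⟨⟨hUZ₁, hlinkU₁⟩, -⟩, -⟩ := hω₁G
    obtain ⟨x₀, hx₀, u₀, hu₀, harm₁⟩ := hlinkU₁
    have hKball : wireSet (↑(Λ n) : Set V) ⊆ ↑F := by
      rw [hFS]; exact KozmaNitzan.wireSet_mono (by exact_mod_cast hQS)
    have cyl_iff : ∀ ω' ∈ localCylinder (↑F : Set (Sym2 V)) ω, ∀ e ∈ wireSet (↑(Λ n) : Set V),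
        e ∈ ω₁ ↔ e ∈ ω' := by
      intro ω' hω' e he
      exact (hω₁c e (hKball he)).trans (hω' e (hKball he)).symm
    refine ⟨u₀, hu₀, ?_⟩
    -- `𝒢 ∩ [ω]_F ⊆ {u₀ ↔ T inside Rg}`
    have key : Gd ∩ localCylinder ↑F ω ⊆ ⋃ t ∈ T, openConnIn Rg u₀ t := by
      rintro ω' ⟨⟨⟨⟨hUZ', -⟩, hlinkT'⟩, hlatt'⟩, hω'c⟩
      have hc := cyl_iff ω' hω'c
      -- the arm from `x₀` to `u₀` inside the cube, in `ω'`
      have harm' : ω' ∈ openConnIn (↑(Λ n)) x₀ u₀ := by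
        rw [DCT16.mem_openConnIn_iff_pathIn] at harm₁ ⊢
        exact KozmaNitzan.pathIn_openGraph_congr hc harm₁
      -- the route to `Ft`, exiting the cube through an edge of `G`
      obtain ⟨x', hx', t', ht', hroute⟩ := hlinkT'
      have ht'ball : t' ∉ (↑(Λ n) : Set V) := fun h' =>
        Finset.disjoint_left.1 hfar ht' (Finset.mem_coe.1 h')
      have hx'ball : x' ∈ (↑(Λ n) : Set V) := Finset.mem_coe.2 (hkn hx')
      have hrouteIn : ω' ∈ openConnIn (↑Qt) x' t' := hroute
      rw [DCT16.mem_openConnIn_iff_pathIn] at hroute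
      obtain ⟨a, b, ha, hb, hbQt, hab, hpa⟩ := hroute.exit hx'ball ht'ball
      have haQt : a ∈ (↑Qt : Set V) := hpa.right_mem.2
      -- `s(a,b)` is open inside `D`, hence an edge of `G`
      have hadj : G.Adj a b := by
        rw [openGraph_adj] at hab
        have hmem : s(a, b) ∈ pairsF D := by
          simp only [pairsF, Finset.mem_filter, Finset.mk_mem_sym2_iff, Sym2.mk_isDiag_iff]
          exact ⟨⟨hQt (Finset.mem_coe.1 haQt), hQt (Finset.mem_coe.1 hbQt)⟩, hab.2⟩
        have := hlatt' _ hmem hab.1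
        rwa [SimpleGraph.mem_edgeSet] at this
      have habdry : a ∈ innerBoundary G (Λ n) := by
        rw [mem_innerBoundary_iff]
        exact ⟨Finset.mem_coe.1 ha, b, fun h' => hb (Finset.mem_coe.2 h'), hadj⟩
      have hx'bd : ω' ∈ UniqZone.toBdry G Λ n x' := ⟨a, habdry, by
        rw [DCT16.mem_openConnIn_iff_pathIn]; exact hpa.mono Set.inter_subset_left⟩
      have hx₀bd : ω' ∈ UniqZone.toBdry G Λ n x₀ := ⟨u₀, hU hu₀, harm'⟩
      have hconn : ω' ∈ openConnIn (↑(Λ n)) x₀ x' := hUZ' x₀ hx₀ x' hx' hx₀bd hx'bd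
      -- chain `u₀ ↔ x₀ ↔ x' ↔ t'`, all inside `Rg`
      have hmono : ∀ {A : Set V} {x y : V}, A ⊆ Rg → ω' ∈ openConnIn A x y →
          ω' ∈ openConnIn Rg x y := fun hA h => by
        rw [DCT16.mem_openConnIn_iff_pathIn] at h ⊢
        exact h.mono hA
      simp only [Set.mem_iUnion, exists_prop]
      refine ⟨t', hT ht', ?_⟩
      exact GM.openConnIn_trans (GM.openConnIn_trans (GM.openConnIn_comm.1 (hmono hRb harm'))
        (hmono hRb hconn)) (hmono hRQ hrouteIn)
    have hge := measureReal_mono (μ := prodBernoulli (pinW W ↑F ω)) key (measure_ne_top _ _)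
    rw [prodBernoulli_pinW_real_inter_localCylinder W (F.finite_toSet.countable) ω Gd] at hge
    rw [← hFS]
    exact hω.trans_le hge
  -- conclusion
  have hLm : MeasurableSet (pinLow W (↑F : Set (Sym2 V)) Gd δ) :=
    (determinedBy_pinLow W (↑F) Gd δ).measurableSet_of_finset
  calc 1 - 3 * δ ≤ μ.real (pinLow W ↑F Gd δ)ᶜ := by
        rw [measureReal_compl hLm, probReal_univ]; linarith
    _ ≤ μ.real {ω | ∃ u ∈ U,
          1 - δ < (prodBernoulli (pinW W (wireSet (↑S : Set V)) ω)).real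
            (⋃ t ∈ T, openConnIn Rg u t)} := measureReal_mono hincl

/-- **Step IV** (KN pp. 19–21, (21) ⟹ (24) ⟹ (25)) over `G`: under the hypotheses of `stepIV_in`, with probability `≥ 1 - 3δ` some vertex
`u ∈ U` satisfies `P(u ↔ T | ω|_{E(S)}) > 1 - δ`. [cite: KozmaNitzan2024, §4 pp. 19–21 (Step IV, (21)–(25))] -/
theorem stepIV {W : Sym2 V → unitInterval} {p : unitInterval} {D S T U Qt Ft : Finset V}
    (hW : IsSubbox G W p D) (hT : Ft ⊆ T) (hQt : Qt ⊆ D) (Λ : ℕ → Finset V) {k n : ℕ} (hkn : Λ k ⊆ Λ n)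
    (hQS : Λ n ⊆ S) (hU : U ⊆ innerBoundary G (Λ n))
    (hfar : Disjoint Ft (Λ n)) {δ : ℝ} (hδ : 0 < δ)
    (h1 : 1 - δ ^ 2 < (prodBernoulli W).real (UniqZone.zone G Λ k n))
    (h2 : 1 - δ ^ 2 < (prodBernoulli W).real (linkIn (↑(Λ n)) (Λ k) U))
    (h3 : 1 - δ ^ 2 < (prodBernoulli W).real (linkIn (↑Qt) (Λ k) Ft)) :
    1 - 3 * δ ≤ (prodBernoulli W).real {ω | ∃ u ∈ U, GoodVertex W S T δ ω u} := by
  refine (stepIV_in hW hT hQt Λ hkn hQS hU hfar hδ (Rg := Set.univ) (Set.subset_univ _) (Set.subset_univ _)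
    h1 h2 h3).trans (measureReal_mono ?_ (measure_ne_top _ _))
  rintro ω ⟨u, hu, h⟩
  refine ⟨u, hu, ?_⟩
  unfold GoodVertex
  simpa only [KozmaNitzan.openConnIn_univ_eq'] using h

end KNLevels

end Transplant

end Summit.CriticalPhenomena.PercolationContinuityZ3.Theorems

end
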